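import Summits.Ventures.PercRepro.RankLevelSetExplicitLin2Band
import Summits.Ventures.PercRepro.RankLevelSetExplicitLin2Floor

/-!
# PercRepro — THE BAND BELOW THE FLOOR: THE OPEN PART OF C-025 AT EVERY LEVEL `q ≥ 8` IS ITS BAND CELLS OF RANK
`p < Pfloor q` (p9, S4)

`proofs/SUBCLAIM-S4-p9.md` §S4.2⁗″ / §S4.3⁗. `BandOpen q p d` (RankLevelSetExplicitLin2Band) is the `e`-free core cell
the certified per-corank tools miss, below the uniform threshold `q·2^{q+1}`; the floor rows (RankLevelSetExplicitLin2Floor: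
`c025_floor`, `Pfloor q = 8 710 / 18 780 / … / 807 858` at `q = 10 … 16`) close EVERY cell of rank `p ≥ Pfloor q`. So the
band is cut at the floor: `BandOpenFloor q p d := p < Pfloor q ∧ BandOpen q p d`, every core cell outside it is closed
(`rls_core_of_not_bandFloor`), and the crux is its band cells below the floor (`c025_of_bandFloor_cells`,
`c025_iff_bandFloor_cells`) — at level `10` the band of rank `8 710` is empty (`not_bandOpenFloor_of_le`; at `q·2^{q+1}/2 = 10 240`
the Band module's twin had `99 … 648` open). Axioms: standard.
-/

open scoped Matroid

namespace PercRepro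

namespace ThmN

variable {α : Type}

/-- **THE BAND BELOW THE FLOOR**: a band cell (`BandOpen`) of rank `p < Pfloor q`. -/
def BandOpenFloor (q p d : ℕ) : Prop := p < Pfloor q ∧ BandOpen q p d

/-- From the floor rank on, the band is empty: `¬ BandOpenFloor q p d` for every `p ≥ Pfloor q` and every corank `d`. -/
theorem not_bandOpenFloor_of_le (q p d : ℕ) (hp : Pfloor q ≤ p) : ¬ BandOpenFloor q p d := fun h => by
  have := h.1
  omega

/-- **EVERY CORE CELL OUTSIDE THE BAND BELOW THE FLOOR IS CLOSED** (level `q ≥ 8`): `rls_core_of_not_band` below the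
floor, the floor row (`c025_floor`) from it on. -/
theorem rls_core_of_not_bandFloor (q : ℕ) (hq : 8 ≤ q) (M : Matroid α) [M.Finite] (p d : ℕ)
    (hR : M.eRank = (p : ℕ∞)) (hn : M.E.ncard = p + d)
    (hfree : ∀ e ∈ M.E, ∃ A ⊆ M.E \ {e}, e ∉ M.closure A ∧ e ∉ M.closure ((M.E \ {e}) \ A))
    (hb : ¬ BandOpenFloor q p d) : RLS M p q := by
  by_cases hp : p < Pfloor q
  · exact rls_core_of_not_band q hq M p d hR hn hfree (fun h => hb ⟨hp, h⟩)
  · exact c025_floor q (by omega) M p (by omega)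

/-- **THE CRUX IS ITS BAND CELLS BELOW THE FLOOR**: `C025` follows from the simple, coloop-free, `e`-free core cells
`(p, n)` with `q + 2 ≤ p ≤ q·2^{q+1}`, `n < Nexp p q` (`q ≥ 4`) whose corank lies in the band below the floor at every
level `q ≥ 8` (`c025_of_band_cells` with the floor rows). -/
theorem c025_of_bandFloor_cells
    (hcells : ∀ q, 4 ≤ q → ∀ {α : Type} (M : Matroid α) [M.Finite] (p : ℕ), q + 2 ≤ p → p ≤ q * 2 ^ (q + 1) →
      M.E.ncard < Nexp p q → (∀ e ∈ M.E, ∀ f ∈ M.E, e ≠ f → M.eRk {e, f} = 2) → M.eRank = (p : ℕ∞) →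
      (∀ e, ¬ M.IsColoop e) →
      (∀ e ∈ M.E, ∃ A ⊆ M.E \ {e}, e ∉ M.closure A ∧ e ∉ M.closure ((M.E \ {e}) \ A)) →
      (8 ≤ q → BandOpenFloor q p (M.E.ncard - p)) → RLS M p q) : C025 := by
  refine c025_of_band_cells ?_
  intro q hq β M _ p hpq hpP hn hs hR hc hfree hb
  by_cases hp : p < Pfloor q
  · exact hcells q hq M p hpq hpP hn hs hR hc hfree (fun h8 => ⟨hp, hb h8⟩)
  · rcases Nat.lt_or_ge q 7 with h7 | h7
    · exfalso
      have : Pfloor q = q * 2 ^ (q + 1) + 1 := by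
        unfold Pfloor
        split_ifs <;> omega
      omega
    · exact c025_floor q h7 M p (by omega)

/-- **THE CRUX IS ITS BAND CELLS BELOW THE FLOOR** (both directions). -/
theorem c025_iff_bandFloor_cells :
    C025 ↔ (∀ q, 4 ≤ q → ∀ {α : Type} (M : Matroid α) [M.Finite] (p : ℕ), q + 2 ≤ p → p ≤ q * 2 ^ (q + 1) →
      M.E.ncard < Nexp p q → (∀ e ∈ M.E, ∀ f ∈ M.E, e ≠ f → M.eRk {e, f} = 2) → M.eRank = (p : ℕ∞) →
      (∀ e, ¬ M.IsColoop e) →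
      (∀ e ∈ M.E, ∃ A ⊆ M.E \ {e}, e ∉ M.closure A ∧ e ∉ M.closure ((M.E \ {e}) \ A)) →
      (8 ≤ q → BandOpenFloor q p (M.E.ncard - p)) → RLS M p q) :=
  ⟨fun h q _ _ M _ p hpq _ _ _ _ _ _ _ => h M p q hpq, c025_of_bandFloor_cells⟩

/-- At level `10` the band is empty from rank `8 710` on (the Band module's twin at `10 240 = q·2^{q+1}/2` had the
coranks `99 … 648` open). -/
theorem not_bandOpenFloor_ten (p d : ℕ) (hp : 8710 ≤ p) : ¬ BandOpenFloor 10 p d :=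
  not_bandOpenFloor_of_le 10 p d (by unfold Pfloor; norm_num; omega)

end ThmN

end PercRepro
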